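import Literature.Analysis.FluidPDE.EyinkMatrixKernels
import Literature.Analysis.FluidPDE.EyinkBalanceLimits
import Literature.Analysis.FluidPDE.NovackMatrixKernelProofs
import Literature.Analysis.FluidPDE.NovackKernelAverages
import Literature.Analysis.FunctionSpaces.TorusSpaceTimeFields
import HarnessLib

/-!
# Eyink's transverse balance (uuT-eq) at scale `ε` from the matrix-kernel facts (excised profiles)

Topic: Analysis/FluidPDE, proofs. Second support file (after
`Literature.Analysis.FluidPDE.EyinkMatrixKernels`) for the discharge of the named fact
`Torus.eyink_transverse_balance` (`Literature.Analysis.FluidPDE.EyinkBalance`; G. L. Eyink,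
Nonlinearity 16 (2003) 137–145, §2, (uuT-eq)). Everything here is proved; the only definitions
are the auxiliary `Torus.unitVec` (a fixed unit coordinate vector) and `Torus.eyinkProfile φ ε`
(the square profile of `φ^ε`, so that Eyink's kernels at scale `ε` are
`eyinkMatKernelT (eyinkProfile φ ε)`, `eyinkPotentialT d (eyinkProfile φ ε)`).

## Main result

`Torus.eyinkBalanceT_eq_of_matrix_facts`: granted the tree's two named facts for smooth matrix
kernels — `Torus.integral_matKernelFlux_mul_eq` (the matrix cubic identity, Novack 2024 (mess:one);
Eyink's (id-T), second equality) and `Torus.IsDistributionalNSSolutionOn.matSymmTestField_identity`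
(the momentum equation tested with the matrix-mollified fields; Eyink's (eq-u-LT)) — for every
distributional Euler solution `(u,p)` on `T^d × (0,T)`, `d ≥ 2`, with `u ∈ L³`, `p ∈ L^{3/2}`, every
nonnegative spherically symmetric bump `φ` supported in the unit ball **and vanishing on a ball
around the origin**, every `ε > 0` and every test function `ψ` supported in `(0,T)`,
`𝓔_T^{ε,φ}(ψ) = (4(d−1)/d) ∫₀ᵀ∫ D_T^{ε,φ}(u) ψ`
— the conclusion of `eyink_transverse_balance` for such profiles. The excision is removed in
`EyinkBalanceProofs` (both sides are continuous in the profile at fixed `ε`), where the fact is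
derived for all spherically symmetric mollifiers.

## Proof architecture

For the smooth, even, symmetric torus kernel `M_T = periodize m_T`, `m_T^{ij}(y) = (δᵢⱼ − ŷᵢŷⱼ)φ^ε(y)`
(smooth because `φ^ε` vanishes near `0`), with smooth even potential `ζ = periodize (Z_T∘|·|²)`,
`∑ᵢ∂ᵢM^{ij} = ∂ⱼζ` (`EyinkMatrixKernels`):

1. *The identity for `M_T`*: the two facts and the proved pressure step
   `Torus.integral_pressure_divergence_matSymmTestField` (`NovackMatrixKernelProofs`) combine to
   `2∫∫⟪u,u_M⟫∂ₜψ + 2∫∫⟪u,u_M⟫⟪u,∇ψ⟫ + ∫∫⟪(u|u_M|²),∇ψ⟫ − ∫∫(|u_M|²)⟪u,∇ψ⟫ + 2∫∫p⟪u_M,∇ψ⟫ + 2∫∫(p⋆ζ)⟪u,∇ψ⟫ = ∫∫𝒟_M(u)ψ`.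
2. *Bridges* (§ Objects): at every time slice `v ∈ L³(T^d)` / `q ∈ L¹(T^d)`,
   `u_M = u_T^ε` (`matConv_eyinkMatKernelT_eq`), `(|u_M|²) = (u_T·u_T)^ε`, `(u|u_M|²) = ((u_T·u_T)u)^ε`,
   `q ⋆ ζ = q_T^ε` (the kernels `Z_T(|ξ|²)` and Eyink's `φ_T^ε(ξ)` agree off `ξ = 0`), and
   `𝒟_M(v)(x) = ∫ {∇φ^ε·δv|δv_T|² − (2/|ξ|)φ^ε δv_L|δv_T|²} dξ` (`matKernelFlux_eyinkMatKernelT_eq`: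
   `∂ₗ∘periodize = periodize∘∂ₗ`, the unfolding `∫_{T^d}(periodize H)F = ∫_{ℝ^d} H·F∘π`
   (`integral_periodize_mul`, Stein–Weiss VII §2 Thm. 2.4) and Eyink's (id-T), first equality,
   `eyinkTransverseIntegrand_eq_sum_fderiv`).
3. *Splitting `𝓔_T` into the six integrals* (`eyinkBalanceT_eq_sum`): each piece is integrable on
   `(0,T) × T^d` (`eyink_piecesT_integrable`: the Type I–IV integrability of `EyinkBalanceLimits`
   with the crude translation moduli `2‖u‖_{L³}`, `2‖p‖_{L^{3/2}}` from Minkowski's inequality), and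
   Fubini.

## References

* G. L. Eyink, *Local 4/5-law and energy dissipation anomaly in turbulence*, Nonlinearity 16 (2003)
  137–145 = arXiv:nlin/0208004, §2: (u-LT)–(simp-eq-u-LT), (uuT-eq), (id-T). [Eyink2003]
* M. Novack, Nonlinearity 37 (2024) 095002, §2 Step 0 and Step 2 ((eq:1)–(eq:2), (mess:one)):
  the smooth matrix-kernel form of the computation. [Novack2024]
* E. M. Stein, G. Weiss, *Introduction to Fourier Analysis on Euclidean Spaces* (1971), Ch. VII §2,
  Thm. 2.4 (periodisation and integrals). [SteinWeiss1971]
-/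

noncomputable section

open MeasureTheory TopologicalSpace Set Function Filter Metric
open _root_.Topology
open scoped ENNReal NNReal Convolution ContDiff InnerProductSpace RealInnerProductSpace

namespace Literature.Analysis.FluidPDE.Torus

variable {d : Type*} [Fintype d] [DecidableEq d]

/-! ## Pairings with periodised kernels as Euclidean integrals -/

section Bridge

variable {F : Type*} [NormedAddCommGroup F] [NormedSpace ℝ F]

/-- For a continuous `H` supported in a ball and `f ∈ L¹(T^d)`, `ξ ↦ H(ξ) • f(π ξ)` is integrable on
`ℝ^d` (the lift of `f` is integrable on bounded sets). [folklore] -/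
theorem integrable_smul_comp_proj {H : EuclideanSpace ℝ d → ℝ} (hHc : Continuous H) {R : ℝ}
    (hHs : tsupport H ⊆ closedBall 0 R) {f : UnitAddTorus d → F} (hf : Integrable f volume) :
    Integrable (fun ξ => H ξ • f (FunctionSpaces.Torus.proj ξ)) volume := by
  have hlift : IntegrableOn (FunctionSpaces.Torus.lift f) (closedBall 0 R) volume :=
    FunctionSpaces.Torus.integrableOn_lift_of_subset_closedBall hf Subset.rfl
  have hK : IntegrableOn (fun ξ => H ξ • f (FunctionSpaces.Torus.proj ξ)) (closedBall 0 R) volume :=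
    hlift.continuousOn_smul hHc.continuousOn (isCompact_closedBall _ _)
  refine hK.integrable_of_forall_notMem_eq_zero fun ξ hξ => ?_
  rw [image_eq_zero_of_notMem_tsupport (fun h => hξ (hHs h)), zero_smul]

/-- Translated form: `ξ ↦ H(ξ) • f(x + π ξ)` is integrable for `f ∈ L¹(T^d)`. [folklore] -/
theorem integrable_smul_translate_proj {H : EuclideanSpace ℝ d → ℝ} (hHc : Continuous H) {R : ℝ}
    (hHs : tsupport H ⊆ closedBall 0 R) {f : UnitAddTorus d → F} (hf : Integrable f volume)
    (x : UnitAddTorus d) :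
    Integrable (fun ξ => H ξ • f (x + FunctionSpaces.Torus.proj ξ)) volume :=
  integrable_smul_comp_proj hHc hHs (hf.comp_add_left x)

/-- Scalar form of `integrable_smul_translate_proj`. [folklore] -/
theorem integrable_mul_translate_proj {H : EuclideanSpace ℝ d → ℝ} (hHc : Continuous H) {R : ℝ}
    (hHs : tsupport H ⊆ closedBall 0 R) {f : UnitAddTorus d → ℝ} (hf : Integrable f volume)
    (x : UnitAddTorus d) :
    Integrable (fun ξ => H ξ * f (x + FunctionSpaces.Torus.proj ξ)) volume :=
  integrable_smul_translate_proj hHc hHs hf x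

/-- Scalar form of `integrable_smul_comp_proj`. [folklore] -/
theorem integrable_mul_comp_proj {H : EuclideanSpace ℝ d → ℝ} (hHc : Continuous H) {R : ℝ}
    (hHs : tsupport H ⊆ closedBall 0 R) {f : UnitAddTorus d → ℝ} (hf : Integrable f volume) :
    Integrable (fun ξ => H ξ * f (FunctionSpaces.Torus.proj ξ)) volume :=
  integrable_smul_comp_proj hHc hHs hf

/-- **Unfolding a pairing with a periodised kernel**: for a continuous `H` supported in a ball and
`f ∈ L¹(T^d)`, `∫_{T^d} (periodize H)(z) • f(z) dz = ∫_{ℝ^d} H(ξ) • f(π ξ) dξ`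
(Stein–Weiss, Ch. VII §2, Thm. 2.4: `Torus.integral_eq_integral_perSum_repr`). [folklore] -/
theorem integral_periodize_smul {H : EuclideanSpace ℝ d → ℝ} (hHc : Continuous H) {R : ℝ}
    (hHs : tsupport H ⊆ closedBall 0 R) {f : UnitAddTorus d → F} (hf : Integrable f volume) :
    ∫ z, FunctionSpaces.Torus.periodize H z • f z = ∫ ξ, H ξ • f (FunctionSpaces.Torus.proj ξ) := by
  set g : EuclideanSpace ℝ d → F := fun ξ => H ξ • f (FunctionSpaces.Torus.proj ξ) with hg
  have hgi : Integrable g volume := integrable_smul_comp_proj hHc hHs hf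
  have hgs : support g ⊆ closedBall 0 R := by
    refine fun ξ hξ => hHs (subset_tsupport _ fun h0 => hξ ?_)
    simp only [hg, h0, zero_smul]
  rw [show (∫ ξ, H ξ • f (FunctionSpaces.Torus.proj ξ)) = ∫ ξ, g ξ from rfl,
    FunctionSpaces.Torus.integral_eq_integral_perSum_repr hgi hgs]
  refine integral_congr_ae (ae_of_all _ fun z => ?_)
  have hz : ‖FunctionSpaces.Torus.repr z‖ ≤ Fintype.card d :=
    FunctionSpaces.Torus.norm_le_card_of_mem_unitCube (FunctionSpaces.Torus.repr_mem_unitCube z)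
  obtain ⟨n, hn⟩ := exists_nat_ge (R + Fintype.card d)
  dsimp only
  rw [FunctionSpaces.Torus.periodize_apply, FunctionSpaces.Torus.perSum_eq_sum hgs hz hn,
    FunctionSpaces.Torus.perSum_eq_sum ((subset_tsupport _).trans hHs) hz hn, Finset.sum_smul]
  refine Finset.sum_congr rfl fun k _ => ?_
  simp only [hg, FunctionSpaces.Torus.proj_add_latticeVec, FunctionSpaces.Torus.proj_repr]

/-- Scalar form of `integral_periodize_smul`. [folklore] -/
theorem integral_periodize_mul {H : EuclideanSpace ℝ d → ℝ} (hHc : Continuous H) {R : ℝ}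
    (hHs : tsupport H ⊆ closedBall 0 R) {f : UnitAddTorus d → ℝ} (hf : Integrable f volume) :
    ∫ z, FunctionSpaces.Torus.periodize H z * f z = ∫ ξ, H ξ * f (FunctionSpaces.Torus.proj ξ) :=
  integral_periodize_smul hHc hHs hf

end Bridge

end Literature.Analysis.FluidPDE.Torus

namespace Literature.Analysis.FluidPDE.Torus

variable {d : Type*} [Fintype d] [DecidableEq d]

/-! ## Eyink's kernel data at scale `ε` for a bump excised at the origin -/

section KernelData

variable [Nonempty d]

variable (d) in
/-- A fixed unit coordinate vector of `ℝ^d` (`d` nonempty), along which radial profiles are read. [folklore] -/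
def unitVec : EuclideanSpace ℝ d :=
  EuclideanSpace.single (Classical.arbitrary d) (1 : ℝ)

/-- `‖unitVec d‖ = 1`. [folklore] -/
theorem norm_unitVec : ‖unitVec d‖ = 1 := by
  classical
  simp [unitVec]

/-- **The square profile of `φ^ε`**, `G(s) = φ^ε(√s e)`: for a spherically symmetric `φ`,
`φ^ε(y) = G(|y|²)`; Eyink's matrix kernels and pressure potentials at scale `ε` are
`eyinkMatKernelT/L G`, `eyinkPotentialT/L d G` (`EyinkMatrixKernels`). [cite: Eyink2003, §2 (moll-u-LT)] -/
def eyinkProfile (φ : EuclideanSpace ℝ d → ℝ) (ε : ℝ) : ℝ → ℝ :=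
  sqProfile (FluidPDE.mollifierScale ε φ) (unitVec d)

variable {φ : EuclideanSpace ℝ d → ℝ} {ε r₀ : ℝ}

/-- The profile facts of `sqProfile_mollifierScale_facts` for `eyinkProfile`. [folklore] -/
theorem eyinkProfile_facts (hφ : IsRadialBump φ) (hr₀ : 0 < r₀)
    (h0 : ∀ ξ : EuclideanSpace ℝ d, ‖ξ‖ < r₀ → φ ξ = 0) (hε : 0 < ε) :
    ContDiff ℝ ∞ (eyinkProfile φ ε) ∧
      (∀ s, s < (ε * r₀) ^ 2 → eyinkProfile φ ε s = 0) ∧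
      (∃ R : ℝ, 0 ≤ R ∧ (∀ s, R ^ 2 ≤ s → eyinkProfile φ ε s = 0) ∧
        ∀ ξ : EuclideanSpace ℝ d, R ≤ ‖ξ‖ → FluidPDE.mollifierScale ε φ ξ = 0) ∧
      ∀ y : EuclideanSpace ℝ d, FluidPDE.mollifierScale ε φ y = eyinkProfile φ ε (‖y‖ ^ 2) :=
  sqProfile_mollifierScale_facts hφ hr₀ h0 hε norm_unitVec

end KernelData

/-! ## Euclidean kernel integrands built on translated `L¹` slices: integrability -/

section KernelIntegrands

variable {F : Type*} [NormedAddCommGroup F] [NormedSpace ℝ F]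

/-- For a continuous kernel `k` supported in a ball, a jointly continuous `Φ(ω, w)` with
`‖Φ(ω,w)‖ ≤ C‖w‖` on `‖ω‖ ≤ 1`, and `v ∈ L¹(T^d)`: `ξ ↦ k(ξ) • Φ(ξ̂, v(x + πξ))` is integrable on
`ℝ^d`. [folklore] -/
theorem integrable_kernel_smul_dirMap {k : EuclideanSpace ℝ d → ℝ} (hkc : Continuous k) {R : ℝ}
    (hks : tsupport k ⊆ closedBall 0 R)
    {Φ : EuclideanSpace ℝ d → EuclideanSpace ℝ d → F} (hΦc : Continuous (uncurry Φ)) {C : ℝ}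
    (hΦ : ∀ o w : EuclideanSpace ℝ d, ‖o‖ ≤ 1 → ‖Φ o w‖ ≤ C * ‖w‖)
    {v : UnitAddTorus d → EuclideanSpace ℝ d} (hv : Integrable v volume) (x : UnitAddTorus d) :
    Integrable (fun ξ => k ξ • Φ (‖ξ‖⁻¹ • ξ) (v (x + FunctionSpaces.Torus.proj ξ))) volume := by
  have hvm : AEStronglyMeasurable (fun ξ : EuclideanSpace ℝ d => v (x + FunctionSpaces.Torus.proj ξ)) volume :=
    (hv.comp_add_left x).aestronglyMeasurable.comp_quasiMeasurePreserving
      FunctionSpaces.Torus.quasiMeasurePreserving_proj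
  have hmeas : AEStronglyMeasurable
      (fun ξ => k ξ • Φ (‖ξ‖⁻¹ • ξ) (v (x + FunctionSpaces.Torus.proj ξ))) volume :=
    hkc.aestronglyMeasurable.smul
      (hΦc.comp_aestronglyMeasurable (measurable_unitDir.aestronglyMeasurable.prodMk hvm))
  have hdom : Integrable (fun ξ => C * ‖k ξ • v (x + FunctionSpaces.Torus.proj ξ)‖) volume :=
    ((integrable_smul_translate_proj hkc hks hv x).norm).const_mul C
  refine hdom.mono' hmeas (ae_of_all _ fun ξ => ?_)
  rw [norm_smul, norm_smul]
  calc ‖k ξ‖ * ‖Φ (‖ξ‖⁻¹ • ξ) (v (x + FunctionSpaces.Torus.proj ξ))‖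
      ≤ ‖k ξ‖ * (C * ‖v (x + FunctionSpaces.Torus.proj ξ)‖) := by
        gcongr
        exact hΦ _ _ (norm_unitDir_le ξ)
    _ = C * (‖k ξ‖ * ‖v (x + FunctionSpaces.Torus.proj ξ)‖) := by ring

omit [DecidableEq d] in
/-- Products of two components of an `L²` field are integrable. [folklore] -/
theorem integrable_apply_mul_apply_of_memLp {v : UnitAddTorus d → EuclideanSpace ℝ d} (hv : MemLp v 2 volume) (i j : d) :
    Integrable (fun y => v y i * v y j) volume := by
  have h2 : Integrable (fun y => ‖v y‖ ^ 2) volume := hv.integrable_norm_pow two_ne_zero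
  refine h2.mono' ((hv.eval_piLp i).aestronglyMeasurable.mul (hv.eval_piLp j).aestronglyMeasurable)
    (ae_of_all _ fun y => ?_)
  rw [norm_mul]
  calc ‖v y i‖ * ‖v y j‖ ≤ ‖v y‖ * ‖v y‖ := by
        gcongr <;> exact PiLp.norm_apply_le _ _
    _ = ‖v y‖ ^ 2 := (sq _).symm

omit [DecidableEq d] in
/-- Triple products of components of an `L³` field are integrable. [folklore] -/
theorem integrable_apply_mul_apply_mul_apply_of_memLp {v : UnitAddTorus d → EuclideanSpace ℝ d} (hv : MemLp v 3 volume)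
    (i j l : d) : Integrable (fun y => v y i * v y j * v y l) volume := by
  have h3 : Integrable (fun y => ‖v y‖ ^ 3) volume := hv.integrable_norm_pow three_ne_zero
  refine h3.mono' (((hv.eval_piLp i).aestronglyMeasurable.mul (hv.eval_piLp j).aestronglyMeasurable).mul
    (hv.eval_piLp l).aestronglyMeasurable) (ae_of_all _ fun y => ?_)
  rw [norm_mul, norm_mul]
  calc ‖v y i‖ * ‖v y j‖ * ‖v y l‖ ≤ ‖v y‖ * ‖v y‖ * ‖v y‖ := by
        gcongr <;> exact PiLp.norm_apply_le _ _
    _ = ‖v y‖ ^ 3 := by ring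

omit [DecidableEq d] in
/-- The increment field `z ↦ v(x+z) − v(x)` of an `L³` field is in `L³`. [folklore] -/
theorem memLp_increment_three {v : UnitAddTorus d → EuclideanSpace ℝ d} (hv : MemLp v 3 volume)
    (x : UnitAddTorus d) : MemLp (fun z => v (x + z) - v x) 3 volume :=
  (hv.comp_measurePreserving (measurePreserving_add_left volume x)).sub (memLp_const _)

end KernelIntegrands

/-! ## Eyink's objects for an excised bump are the matrix objects of its smooth kernel -/

section Objects

variable [Nonempty d] {φ : EuclideanSpace ℝ d → ℝ} {ε r₀ : ℝ}

omit [DecidableEq d] [Nonempty d] in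
/-- `‖P_T(ξ̂) w‖² = ‖w‖² − ⟪ξ̂, w⟫²` for the unit direction `ξ̂ = |ξ|⁻¹ξ` (also at `ξ = 0`, where
`ξ̂ = 0`). [folklore] -/
theorem norm_projT_unitDir_sq (ξ w : EuclideanSpace ℝ d) :
    ‖projT (‖ξ‖⁻¹ • ξ) w‖ ^ 2 = ‖w‖ ^ 2 - ⟪‖ξ‖⁻¹ • ξ, w⟫ ^ 2 := by
  rw [projT_apply, norm_sub_sq_real, norm_smul, real_inner_smul_right]
  by_cases hξ : ξ = 0
  · subst hξ
    simp
  · rw [norm_inv_norm_smul hξ, Real.norm_eq_abs, mul_one, sq_abs, real_inner_comm]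
    ring

/-- **`u_T^ε = u_{M_T}`**: for `v ∈ L¹(T^d)`, Eyink's mollified transverse velocity equals the
matrix mollification by the periodised transverse kernel of the excised bump
(Eyink 2003, (moll-u-LT); Novack 2024, (increments a)). [cite: Eyink2003, §2 (moll-u-LT)] -/
theorem matConv_eyinkMatKernelT_eq (hφ : IsRadialBump φ) (hr₀ : 0 < r₀)
    (h0 : ∀ ξ : EuclideanSpace ℝ d, ‖ξ‖ < r₀ → φ ξ = 0) (hε : 0 < ε)
    {v : UnitAddTorus d → EuclideanSpace ℝ d} (hv : Integrable v volume) (x : UnitAddTorus d) :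
    matConv v (eyinkMatKernelT (d := d) (eyinkProfile φ ε)) x = eyinkVelocityT φ ε v x := by
  obtain ⟨hG, hGa, ⟨R, hR0, hGR, hkR⟩, hk⟩ := eyinkProfile_facts hφ hr₀ h0 hε
  have ha : 0 < (ε * r₀) ^ 2 := by positivity
  have hmc : ∀ i j : d, Continuous (eyinkMatKernelTE (eyinkProfile φ ε) i j) := fun i j =>
    (contDiff_eyinkMatKernelTE hG ha hGa i j).continuous
  have hms : ∀ i j : d, tsupport (eyinkMatKernelTE (eyinkProfile φ ε) i j) ⊆ closedBall (0 : EuclideanSpace ℝ d) R :=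
    tsupport_eyinkMatKernelTE_subset hR0 hGR
  have hkc : Continuous (FluidPDE.mollifierScale ε φ) := (hφ.mollifierScale hε.ne').smooth.continuous
  have hks : tsupport (FluidPDE.mollifierScale ε φ) ⊆ closedBall (0 : EuclideanSpace ℝ d) R :=
    tsupport_subset_closedBall_of_eq_zero hkR
  -- the Euclidean integrand of `u_T^ε`
  have hint : Integrable (fun ξ : EuclideanSpace ℝ d => FluidPDE.mollifierScale ε φ ξ •
      (v (x + FunctionSpaces.Torus.proj ξ) -
        ⟪v (x + FunctionSpaces.Torus.proj ξ), ‖ξ‖⁻¹ • ξ⟫ • (‖ξ‖⁻¹ • ξ))) volume := by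
    refine integrable_kernel_smul_dirMap (Φ := fun o w => w - ⟪w, o⟫ • o) hkc hks (by fun_prop) (C := 2)
      (fun o w ho => ?_) hv x
    have h1 : ‖⟪w, o⟫ • o‖ ≤ ‖w‖ := by
      rw [norm_smul, Real.norm_eq_abs]
      calc |⟪w, o⟫| * ‖o‖ ≤ (‖w‖ * ‖o‖) * ‖o‖ := by gcongr; exact abs_real_inner_le_norm _ _
        _ ≤ (‖w‖ * 1) * 1 := by gcongr
        _ = ‖w‖ := by ring
    calc ‖w - ⟪w, o⟫ • o‖ ≤ ‖w‖ + ‖⟪w, o⟫ • o‖ := norm_sub_le _ _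
      _ ≤ ‖w‖ + ‖w‖ := by gcongr
      _ = 2 * ‖w‖ := by ring
  ext i
  have hcomp : (eyinkVelocityT φ ε v x) i = ∫ ξ, (FluidPDE.mollifierScale ε φ ξ •
      (v (x + FunctionSpaces.Torus.proj ξ) -
        ⟪v (x + FunctionSpaces.Torus.proj ξ), ‖ξ‖⁻¹ • ξ⟫ • (‖ξ‖⁻¹ • ξ))) i := by
    rw [eyinkVelocityT]
    exact ((EuclideanSpace.proj i : EuclideanSpace ℝ d →L[ℝ] ℝ).integral_comp_comm hint).symm
  rw [hcomp, matConv_apply]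
  have hconv : ∀ j, ((fun y => v y j) ⋆ eyinkMatKernelT (eyinkProfile φ ε) i j) x =
      ∫ ξ, eyinkMatKernelTE (eyinkProfile φ ε) i j ξ * v (x + FunctionSpaces.Torus.proj ξ) j := fun j =>
    convolution_periodize_apply (hmc i j) (hms i j) (eyinkMatKernelTE_neg _ i j) (hv.eval_piLp j) x
  simp only [hconv]
  rw [← integral_finsetSum _ fun j _ => integrable_mul_translate_proj (hmc i j) (hms i j) (hv.eval_piLp j) x]
  refine integral_congr_ae (ae_of_all _ fun ξ => ?_)
  simp only
  rw [sum_eyinkMatKernelTE_mul, ← hk ξ, real_inner_comm]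
  simp only [PiLp.smul_apply, PiLp.sub_apply, smul_eq_mul]

/-- **`(u_T·u_T)^ε = (|u_M|²)`**: for `v ∈ L²(T^d)`, Eyink's mollified transverse energy equals the
quadratic matrix average (Eyink 2003, (uuT-eq); Novack 2024, (increments c)). [cite: Eyink2003, §2 (uuT-eq)] -/
theorem matConvSq_eyinkMatKernelT_eq (hφ : IsRadialBump φ) (hr₀ : 0 < r₀)
    (h0 : ∀ ξ : EuclideanSpace ℝ d, ‖ξ‖ < r₀ → φ ξ = 0) (hε : 0 < ε)
    {v : UnitAddTorus d → EuclideanSpace ℝ d} (hv : MemLp v 2 volume) (x : UnitAddTorus d) :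
    matConvSq v (eyinkMatKernelT (d := d) (eyinkProfile φ ε)) x = eyinkEnergyT φ ε v x := by
  obtain ⟨hG, hGa, ⟨R, hR0, hGR, hkR⟩, hk⟩ := eyinkProfile_facts hφ hr₀ h0 hε
  have ha : 0 < (ε * r₀) ^ 2 := by positivity
  have hmc : ∀ i j : d, Continuous (eyinkMatKernelTE (eyinkProfile φ ε) i j) := fun i j =>
    (contDiff_eyinkMatKernelTE hG ha hGa i j).continuous
  have hms : ∀ i j : d, tsupport (eyinkMatKernelTE (eyinkProfile φ ε) i j) ⊆ closedBall (0 : EuclideanSpace ℝ d) R :=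
    tsupport_eyinkMatKernelTE_subset hR0 hGR
  have hvij : ∀ i j, Integrable (fun y => v y i * v y j) volume := integrable_apply_mul_apply_of_memLp hv
  rw [(eyink_objectsT_eq φ ε v x).2.1, matConvSq]
  have hconv : ∀ i j, ((fun y => v y i * v y j) ⋆ eyinkMatKernelT (eyinkProfile φ ε) i j) x =
      ∫ ξ, eyinkMatKernelTE (eyinkProfile φ ε) i j ξ *
        (v (x + FunctionSpaces.Torus.proj ξ) i * v (x + FunctionSpaces.Torus.proj ξ) j) := fun i j =>
    convolution_periodize_apply (hmc i j) (hms i j) (eyinkMatKernelTE_neg _ i j) (hvij i j) x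
  simp only [hconv]
  have hI : ∀ i j, Integrable (fun ξ => eyinkMatKernelTE (eyinkProfile φ ε) i j ξ *
      (v (x + FunctionSpaces.Torus.proj ξ) i * v (x + FunctionSpaces.Torus.proj ξ) j)) volume := fun i j =>
    integrable_smul_translate_proj (hmc i j) (hms i j) (hvij i j) x
  simp_rw [← integral_finsetSum _ fun j _ => hI _ j]
  rw [← integral_finsetSum _ fun i _ => integrable_finsetSum _ fun j _ => hI i j]
  refine integral_congr_ae (ae_of_all _ fun ξ => ?_)
  simp only
  rw [sum_sum_eyinkMatKernelTE_mul_mul, ← hk ξ, norm_projT_unitDir_sq]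

/-- **`((u_T·u_T)u)^ε = (u|u_M|²)`**: for `v ∈ L³(T^d)`, Eyink's mollified transverse energy flux
equals the cubic matrix average (Eyink 2003, (uuT-eq); Novack 2024, (increments c)). [cite: Eyink2003, §2 (uuT-eq)] -/
theorem matConvCube_eyinkMatKernelT_eq (hφ : IsRadialBump φ) (hr₀ : 0 < r₀)
    (h0 : ∀ ξ : EuclideanSpace ℝ d, ‖ξ‖ < r₀ → φ ξ = 0) (hε : 0 < ε)
    {v : UnitAddTorus d → EuclideanSpace ℝ d} (hv : MemLp v 3 volume) (x : UnitAddTorus d) :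
    matConvCube v (eyinkMatKernelT (d := d) (eyinkProfile φ ε)) x = eyinkEnergyFluxT φ ε v x := by
  obtain ⟨hG, hGa, ⟨R, hR0, hGR, hkR⟩, hk⟩ := eyinkProfile_facts hφ hr₀ h0 hε
  have ha : 0 < (ε * r₀) ^ 2 := by positivity
  have hmc : ∀ i j : d, Continuous (eyinkMatKernelTE (eyinkProfile φ ε) i j) := fun i j =>
    (contDiff_eyinkMatKernelTE hG ha hGa i j).continuous
  have hms : ∀ i j : d, tsupport (eyinkMatKernelTE (eyinkProfile φ ε) i j) ⊆ closedBall (0 : EuclideanSpace ℝ d) R :=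
    tsupport_eyinkMatKernelTE_subset hR0 hGR
  have hkc : Continuous (FluidPDE.mollifierScale ε φ) := (hφ.mollifierScale hε.ne').smooth.continuous
  have hks : tsupport (FluidPDE.mollifierScale ε φ) ⊆ closedBall (0 : EuclideanSpace ℝ d) R :=
    tsupport_subset_closedBall_of_eq_zero hkR
  have hv1 : Integrable v volume := hv.integrable (by norm_num)
  have hvijl : ∀ i j l, Integrable (fun y => v y i * v y j * v y l) volume := integrable_apply_mul_apply_mul_apply_of_memLp hv
  -- integrability of the Euclidean integrand of `F_T` (cubic in `v`)
  have hint : Integrable (fun ξ : EuclideanSpace ℝ d => (FluidPDE.mollifierScale ε φ ξ *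
      ‖projT (‖ξ‖⁻¹ • ξ) (v (x + FunctionSpaces.Torus.proj ξ))‖ ^ 2) • v (x + FunctionSpaces.Torus.proj ξ)) volume := by
    -- dominate by `|k| ‖v₊‖³ · 4`, integrable since `v ∈ L³`
    have h3 : Integrable (fun y => ‖v y‖ ^ 3) volume := hv.integrable_norm_pow three_ne_zero
    have hdom : Integrable (fun ξ : EuclideanSpace ℝ d => FluidPDE.mollifierScale ε φ ξ •
        ‖v (x + FunctionSpaces.Torus.proj ξ)‖ ^ 3) volume :=
      integrable_smul_translate_proj hkc hks h3 x
    have hvm : AEStronglyMeasurable (fun ξ : EuclideanSpace ℝ d => v (x + FunctionSpaces.Torus.proj ξ)) volume :=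
      (hv1.comp_add_left x).aestronglyMeasurable.comp_quasiMeasurePreserving
        FunctionSpaces.Torus.quasiMeasurePreserving_proj
    have hmeas : AEStronglyMeasurable (fun ξ : EuclideanSpace ℝ d => (FluidPDE.mollifierScale ε φ ξ *
        ‖projT (‖ξ‖⁻¹ • ξ) (v (x + FunctionSpaces.Torus.proj ξ))‖ ^ 2) • v (x + FunctionSpaces.Torus.proj ξ)) volume := by
      refine (hkc.aestronglyMeasurable.mul ?_).smul hvm
      exact (continuous_projT.comp_aestronglyMeasurable
        (measurable_unitDir.aestronglyMeasurable.prodMk hvm)).norm.pow 2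
    refine (hdom.norm.const_mul 4).mono' hmeas (ae_of_all _ fun ξ => ?_)
    rw [norm_smul, norm_mul, norm_pow, norm_norm, norm_smul]
    have hP : ‖projT (‖ξ‖⁻¹ • ξ) (v (x + FunctionSpaces.Torus.proj ξ))‖ ≤ 2 * ‖v (x + FunctionSpaces.Torus.proj ξ)‖ :=
      norm_projT_unit_le ξ _
    calc ‖FluidPDE.mollifierScale ε φ ξ‖ * ‖projT (‖ξ‖⁻¹ • ξ) (v (x + FunctionSpaces.Torus.proj ξ))‖ ^ 2 *
          ‖v (x + FunctionSpaces.Torus.proj ξ)‖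
        ≤ ‖FluidPDE.mollifierScale ε φ ξ‖ * (2 * ‖v (x + FunctionSpaces.Torus.proj ξ)‖) ^ 2 *
          ‖v (x + FunctionSpaces.Torus.proj ξ)‖ := by gcongr
      _ = 4 * (‖FluidPDE.mollifierScale ε φ ξ‖ * ‖‖v (x + FunctionSpaces.Torus.proj ξ)‖ ^ 3‖) := by
          rw [norm_pow, norm_norm]; ring
  ext l
  have hcomp : (eyinkEnergyFluxT φ ε v x) l = ∫ ξ, ((FluidPDE.mollifierScale ε φ ξ *
      ‖projT (‖ξ‖⁻¹ • ξ) (v (x + FunctionSpaces.Torus.proj ξ))‖ ^ 2) • v (x + FunctionSpaces.Torus.proj ξ)) l := by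
    rw [(eyink_objectsT_eq φ ε v x).2.2]
    exact ((EuclideanSpace.proj l : EuclideanSpace ℝ d →L[ℝ] ℝ).integral_comp_comm hint).symm
  rw [hcomp, matConvCube_apply]
  have hconv : ∀ i j, ((fun y => v y i * v y j * v y l) ⋆ eyinkMatKernelT (eyinkProfile φ ε) i j) x =
      ∫ ξ, eyinkMatKernelTE (eyinkProfile φ ε) i j ξ *
        (v (x + FunctionSpaces.Torus.proj ξ) i * v (x + FunctionSpaces.Torus.proj ξ) j *
          v (x + FunctionSpaces.Torus.proj ξ) l) := fun i j =>
    convolution_periodize_apply (hmc i j) (hms i j) (eyinkMatKernelTE_neg _ i j) (hvijl i j l) x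
  simp only [hconv]
  have hI : ∀ i j, Integrable (fun ξ => eyinkMatKernelTE (eyinkProfile φ ε) i j ξ *
      (v (x + FunctionSpaces.Torus.proj ξ) i * v (x + FunctionSpaces.Torus.proj ξ) j *
        v (x + FunctionSpaces.Torus.proj ξ) l)) volume := fun i j =>
    integrable_smul_translate_proj (hmc i j) (hms i j) (hvijl i j l) x
  simp_rw [← integral_finsetSum _ fun j _ => hI _ j]
  rw [← integral_finsetSum _ fun i _ => integrable_finsetSum _ fun j _ => hI i j]
  refine integral_congr_ae (ae_of_all _ fun ξ => ?_)
  simp only [PiLp.smul_apply, smul_eq_mul]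
  have e : ∀ i j, eyinkMatKernelTE (eyinkProfile φ ε) i j ξ *
      (v (x + FunctionSpaces.Torus.proj ξ) i * v (x + FunctionSpaces.Torus.proj ξ) j *
        v (x + FunctionSpaces.Torus.proj ξ) l) =
      (eyinkMatKernelTE (eyinkProfile φ ε) i j ξ *
        (v (x + FunctionSpaces.Torus.proj ξ) i * v (x + FunctionSpaces.Torus.proj ξ) j)) *
          v (x + FunctionSpaces.Torus.proj ξ) l := fun i j => by ring
  simp_rw [e, ← Finset.sum_mul]
  rw [sum_sum_eyinkMatKernelTE_mul_mul, ← hk ξ, norm_projT_unitDir_sq]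

/-- **`p_T^ε = p ⋆ φ_T`**: for `q ∈ L¹(T^d)`, Eyink's transverse pressure equals the torus
convolution with the periodised smooth potential (the two kernels agree off the origin,
`eyinkTransverseKernel_eq_transPotentialProfile`; Eyink 2003, (p-LT)). [cite: Eyink2003, §2 (p-LT)] -/
theorem convolution_eyinkPotentialT_eq (hφ : IsRadialBump φ) (hr₀ : 0 < r₀)
    (h0 : ∀ ξ : EuclideanSpace ℝ d, ‖ξ‖ < r₀ → φ ξ = 0) (hε : 0 < ε)
    {q : UnitAddTorus d → ℝ} (hq : Integrable q volume) (x : UnitAddTorus d) :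
    (q ⋆ eyinkPotentialT d (eyinkProfile φ ε)) x = eyinkPressureT φ ε q x := by
  obtain ⟨hG, hGa, ⟨R, hR0, hGR, hkR⟩, hk⟩ := eyinkProfile_facts hφ hr₀ h0 hε
  have ha : 0 < (ε * r₀) ^ 2 := by positivity
  have hZc : Continuous fun y : EuclideanSpace ℝ d => transPotentialProfile d (eyinkProfile φ ε) (‖y‖ ^ 2) :=
    (contDiff_comp_norm_sq (contDiff_transPotentialProfile hG ha hGa hGR)).continuous
  have hZs : tsupport (fun y : EuclideanSpace ℝ d => transPotentialProfile d (eyinkProfile φ ε) (‖y‖ ^ 2)) ⊆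
      closedBall (0 : EuclideanSpace ℝ d) R :=
    tsupport_comp_norm_sq_subset hR0 fun _ hs => transPotentialProfile_eq_zero hGR hs
  rw [eyinkPotentialT, convolution_periodize_apply hZc hZs (fun y => by simp [norm_neg]) hq x, eyinkPressureT]
  refine integral_congr_ae ?_
  have h0ae : ∀ᵐ ξ : EuclideanSpace ℝ d ∂volume, ξ ≠ 0 := by
    have h : ({(0 : EuclideanSpace ℝ d)}ᶜ : Set (EuclideanSpace ℝ d)) ∈ ae (volume : Measure (EuclideanSpace ℝ d)) :=
      compl_mem_ae_iff.2 (measure_singleton 0)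
    filter_upwards [h] with ξ hξ
    simpa using hξ
  filter_upwards [h0ae] with ξ hξ
  rw [eyinkTransverseKernel_eq_transPotentialProfile hG ha hGa hGR hk hξ]

omit [Fintype d] [DecidableEq d] [Nonempty d] in
/-- A continuous function on the (compact) torus is bounded. [folklore] -/
theorem exists_forall_norm_le_of_continuous {F : Type*} [NormedAddCommGroup F] {g : UnitAddTorus d → F}
    (hg : Continuous g) : ∃ C, ∀ z, ‖g z‖ ≤ C := by
  obtain ⟨C, hC⟩ := (isCompact_range hg.norm).bddAbove
  exact ⟨C, fun z => hC ⟨z, rfl⟩⟩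

omit [DecidableEq d] [Nonempty d] in
/-- A bounded continuous weight times an `L¹` function is integrable on `T^d`. [folklore] -/
theorem integrable_continuous_mul {g f : UnitAddTorus d → ℝ} (hg : Continuous g) (hf : Integrable f volume) :
    Integrable (fun z => g z * f z) volume := by
  obtain ⟨C, hC⟩ := exists_forall_norm_le_of_continuous hg
  exact hf.bdd_mul hg.aestronglyMeasurable (ae_of_all _ hC)

/-- **`𝒟_{M_T}(v) = ∫ {∇φ^ε·δv |δv_T|² − (2/|ξ|)φ^ε δv_L|δv_T|²} dξ`**: for `v ∈ L³(T^d)`, the flux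
through the periodised transverse kernel of an excised bump is the `ξ`-integral of Eyink's
transverse integrand (Eyink 2003, (id-T), first equality; `∂ₗ∘periodize = periodize∘∂ₗ` and the
unfolding `integral_periodize_mul`). [cite: Eyink2003, §2 (id-T)] -/
theorem matKernelFlux_eyinkMatKernelT_eq (hφ : IsRadialBump φ) (hr₀ : 0 < r₀)
    (h0 : ∀ ξ : EuclideanSpace ℝ d, ‖ξ‖ < r₀ → φ ξ = 0) (hε : 0 < ε)
    {v : UnitAddTorus d → EuclideanSpace ℝ d} (hv : MemLp v 3 volume) (x : UnitAddTorus d) :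
    matKernelFlux (eyinkMatKernelT (d := d) (eyinkProfile φ ε)) v x = ∫ ξ, eyinkTransverseIntegrand φ ε v x ξ := by
  obtain ⟨hG, hGa, ⟨R, hR0, hGR, hkR⟩, hk⟩ := eyinkProfile_facts hφ hr₀ h0 hε
  have ha : 0 < (ε * r₀) ^ 2 := by positivity
  set G := eyinkProfile φ ε with hGdef
  -- the derivative kernels `H i j l = ∂ₗ m_T^{ij}`
  set H : d → d → d → EuclideanSpace ℝ d → ℝ := fun i j l y =>
    fderiv ℝ (eyinkMatKernelTE G i j) y (EuclideanSpace.single l 1) with hHdef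
  have hm : ∀ i j : d, ContDiff ℝ ∞ (eyinkMatKernelTE G i j) := fun i j => contDiff_eyinkMatKernelTE hG ha hGa i j
  have hms : ∀ i j : d, tsupport (eyinkMatKernelTE G i j) ⊆ closedBall (0 : EuclideanSpace ℝ d) R :=
    tsupport_eyinkMatKernelTE_subset hR0 hGR
  have hHc : ∀ i j l, Continuous (H i j l) := fun i j l =>
    ((hm i j).continuous_fderiv (by simp)).clm_apply continuous_const
  have hHs : ∀ i j l, tsupport (H i j l) ⊆ closedBall (0 : EuclideanSpace ℝ d) R := by
    intro i j l
    refine (closure_mono fun y hy => ?_).trans ((tsupport_fderiv_subset ℝ).trans (hms i j))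
    rw [mem_support] at hy ⊢
    intro h
    exact hy (by simp [hHdef, h])
  have hHsm : ∀ i j l, ContDiff ℝ ∞ (H i j l) := fun i j l =>
    ((hm i j).fderiv_right (m := ∞) (by simp)).clm_apply contDiff_const
  -- the increment products
  set δ : UnitAddTorus d → EuclideanSpace ℝ d := fun z => v (x + z) - v x with hδdef
  have hδ3 : MemLp δ 3 volume := memLp_increment_three hv x
  have hF : ∀ i j l, Integrable (fun z => δ z i * δ z j * δ z l) volume := integrable_apply_mul_apply_mul_apply_of_memLp hδ3
  -- torus side: `∂ₗ M^{ij} = periodize (H i j l)`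
  have hpd : ∀ i j l z, FunctionSpaces.Torus.partialDeriv l (eyinkMatKernelT G i j) z =
      FunctionSpaces.Torus.periodize (H i j l) z := fun i j l z =>
    partialDeriv_periodize ((hm i j).of_le (by simp)) (hms i j) l z
  have hIT : ∀ i j l, Integrable (fun z => FunctionSpaces.Torus.periodize (H i j l) z * (δ z i * δ z j * δ z l)) volume :=
    fun i j l => integrable_continuous_mul
      (FunctionSpaces.Torus.isSmooth_periodize (hHsm i j l) (hHs i j l)).continuous (hF i j l)
  have hIE : ∀ i j l, Integrable (fun ξ => H i j l ξ * (δ (FunctionSpaces.Torus.proj ξ) i *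
      δ (FunctionSpaces.Torus.proj ξ) j * δ (FunctionSpaces.Torus.proj ξ) l)) volume :=
    fun i j l => integrable_mul_comp_proj (hHc i j l) (hHs i j l) (hF i j l)
  -- both sides as triple sums of single-kernel pairings
  have eL : matKernelFlux (eyinkMatKernelT (d := d) G) v x =
      ∑ i, ∑ j, ∑ l, ∫ z, FunctionSpaces.Torus.periodize (H i j l) z * (δ z i * δ z j * δ z l) := by
    rw [matKernelFlux]
    simp_rw [hpd]
    rw [integral_finsetSum _ fun i _ => integrable_finsetSum _ fun j _ => integrable_finsetSum _ fun l _ => hIT i j l]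
    refine Finset.sum_congr rfl fun i _ => ?_
    rw [integral_finsetSum _ fun j _ => integrable_finsetSum _ fun l _ => hIT i j l]
    refine Finset.sum_congr rfl fun j _ => ?_
    rw [integral_finsetSum _ fun l _ => hIT i j l]
  have eR : ∫ ξ, eyinkTransverseIntegrand φ ε v x ξ =
      ∑ i, ∑ j, ∑ l, ∫ ξ, H i j l ξ * (δ (FunctionSpaces.Torus.proj ξ) i *
        δ (FunctionSpaces.Torus.proj ξ) j * δ (FunctionSpaces.Torus.proj ξ) l) := by
    have hpt : ∀ ξ, eyinkTransverseIntegrand φ ε v x ξ = ∑ i, ∑ j, ∑ l, H i j l ξ *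
        (δ (FunctionSpaces.Torus.proj ξ) i * δ (FunctionSpaces.Torus.proj ξ) j * δ (FunctionSpaces.Torus.proj ξ) l) :=
      fun ξ => eyinkTransverseIntegrand_eq_sum_fderiv hφ hr₀ h0 hε norm_unitVec v x ξ
    simp_rw [hpt]
    rw [integral_finsetSum _ fun i _ => integrable_finsetSum _ fun j _ => integrable_finsetSum _ fun l _ => hIE i j l]
    refine Finset.sum_congr rfl fun i _ => ?_
    rw [integral_finsetSum _ fun j _ => integrable_finsetSum _ fun l _ => hIE i j l]
    refine Finset.sum_congr rfl fun j _ => ?_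
    rw [integral_finsetSum _ fun l _ => hIE i j l]
  rw [eL, eR]
  refine Finset.sum_congr rfl fun i _ => Finset.sum_congr rfl fun j _ => Finset.sum_congr rfl fun l _ => ?_
  exact integral_periodize_mul (hHc i j l) (hHs i j l) (hF i j l)

end Objects

/-! ## Integrability of the six pieces of Eyink's transverse balance pairing -/

section Pieces

variable {T : ℝ}

omit [DecidableEq d] in
/-- **Crude translation modulus** (Minkowski and translation invariance): for `r ≥ 1`,
`(∫⁻ ‖u'∘S_ξ − u'‖ₑ^r)^{1/r} ≤ 2 (∫⁻ ‖u'‖ₑ^r)^{1/r}`. [folklore] -/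
theorem lintegral_translate_sub_rpow_le {F : Type*} [NormedAddCommGroup F] {u' : ℝ × UnitAddTorus d → F}
    (hu : AEStronglyMeasurable u' (stMeasure d T)) {r : ℝ} (hr : 1 ≤ r) (ξ : EuclideanSpace ℝ d) :
    (∫⁻ q, ‖u' (stTranslate d ξ q) - u' q‖ₑ ^ r ∂(stMeasure d T)) ^ (1 / r) ≤
      2 * (∫⁻ q, ‖u' q‖ₑ ^ r ∂(stMeasure d T)) ^ (1 / r) := by
  have hr0 : 0 ≤ 1 / r := by positivity
  have hτ : AEStronglyMeasurable (fun q => u' (stTranslate d ξ q)) (stMeasure d T) :=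
    aestronglyMeasurable_comp_stTranslate_left hu ξ
  calc (∫⁻ q, ‖u' (stTranslate d ξ q) - u' q‖ₑ ^ r ∂(stMeasure d T)) ^ (1 / r)
      ≤ (∫⁻ q, ((fun q => ‖u' (stTranslate d ξ q)‖ₑ) + fun q => ‖u' q‖ₑ) q ^ r ∂(stMeasure d T)) ^ (1 / r) := by
        refine ENNReal.rpow_le_rpow (lintegral_mono fun q => ENNReal.rpow_le_rpow ?_ (zero_le_one.trans hr)) hr0
        exact enorm_sub_le
    _ ≤ (∫⁻ q, ‖u' (stTranslate d ξ q)‖ₑ ^ r ∂(stMeasure d T)) ^ (1 / r) +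
          (∫⁻ q, ‖u' q‖ₑ ^ r ∂(stMeasure d T)) ^ (1 / r) :=
        ENNReal.lintegral_Lp_add_le hτ.enorm hu.enorm hr
    _ = 2 * (∫⁻ q, ‖u' q‖ₑ ^ r ∂(stMeasure d T)) ^ (1 / r) := by
        rw [lintegral_enorm_rpow_comp_stTranslate u' r ξ, two_mul]

/-- `L^r` finiteness is inherited along a pointwise bound `‖c‖ ≤ C‖f‖`. [folklore] -/
theorem lintegral_enorm_rpow_lt_top_of_norm_le {α : Type*} [MeasurableSpace α] {μ : Measure α}
    {E₁ E₂ : Type*} [NormedAddCommGroup E₁] [NormedAddCommGroup E₂] {c : α → E₁} {f : α → E₂} {C r : ℝ}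
    (hC : 0 ≤ C) (hr : 0 ≤ r) (h : ∀ a, ‖c a‖ ≤ C * ‖f a‖) (hf : ∫⁻ a, ‖f a‖ₑ ^ r ∂μ < ⊤) :
    ∫⁻ a, ‖c a‖ₑ ^ r ∂μ < ⊤ := by
  calc ∫⁻ a, ‖c a‖ₑ ^ r ∂μ ≤ ∫⁻ a, (ENNReal.ofReal C * ‖f a‖ₑ) ^ r ∂μ := by
        refine lintegral_mono fun a => ENNReal.rpow_le_rpow ?_ hr
        rw [← ofReal_norm, ← ofReal_norm, ← ENNReal.ofReal_mul hC]
        exact ENNReal.ofReal_le_ofReal (h a)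
    _ = ENNReal.ofReal C ^ r * ∫⁻ a, ‖f a‖ₑ ^ r ∂μ := by
        rw [← lintegral_const_mul' _ _ (ENNReal.rpow_ne_top_of_nonneg hr ENNReal.ofReal_ne_top)]
        exact lintegral_congr fun a => ENNReal.mul_rpow_of_nonneg _ _ hr
    _ < ⊤ := ENNReal.mul_lt_top (ENNReal.rpow_lt_top_of_nonneg hr ENNReal.ofReal_ne_top) hf

variable [Nonempty d] {ε : ℝ} {φ : EuclideanSpace ℝ d → ℝ} {u : ℝ → UnitAddTorus d → EuclideanSpace ℝ d}
  {p : ℝ → UnitAddTorus d → ℝ} {ψ : ℝ → UnitAddTorus d → ℝ}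

omit [DecidableEq d] in
/-- **The kernels of the transverse balance at scale `ε`** for a nonnegative radial bump `φ`
supported in the closed unit ball: `φ^ε` and `φ_T^ε = (φ^ε)_T` are integrable and vanish off the
closed ball of radius `ε`; `φ^ε` is radial and continuous. [folklore] -/
theorem transverse_kernels_facts (hφ : IsRadialBump φ) (hφ0 : ∀ ξ, 0 ≤ φ ξ) (hφ1 : ∀ ξ, 1 < ‖ξ‖ → φ ξ = 0)
    (hε : 0 < ε) :
    Integrable (FluidPDE.mollifierScale ε φ) volume ∧
      (∀ ξ, ε < ‖ξ‖ → FluidPDE.mollifierScale ε φ ξ = 0) ∧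
      (∀ x y : EuclideanSpace ℝ d, ‖x‖ = ‖y‖ → FluidPDE.mollifierScale ε φ x = FluidPDE.mollifierScale ε φ y) ∧
      Integrable (eyinkTransverseKernel d (FluidPDE.mollifierScale ε φ)) volume ∧
      (∀ ξ, ε < ‖ξ‖ → eyinkTransverseKernel d (FluidPDE.mollifierScale ε φ) ξ = 0) := by
  have hk := hφ.mollifierScale hε.ne'
  have hd1 : 1 ≤ Fintype.card d := Fintype.card_pos
  have hkint : Integrable (FluidPDE.mollifierScale ε φ) volume :=
    hk.smooth.continuous.integrable_of_hasCompactSupport hk.hasCompactSupport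
  obtain ⟨hT, -⟩ := integrable_transverseKernel hφ.smooth.continuous hφ.hasCompactSupport hφ0 hd1
  have eT : eyinkTransverseKernel d (FluidPDE.mollifierScale ε φ) = FluidPDE.mollifierScale ε (eyinkTransverseKernel d φ) := by
    funext ξ; exact eyinkTransverseKernel_mollifierScale φ ε ξ
  have eT' : eyinkTransverseKernel d φ = fun ξ => ((Fintype.card d : ℝ) - 1) * ∫ s in Ioi (1 : ℝ), s⁻¹ * φ (s • ξ) := by
    funext ξ; rfl
  refine ⟨hkint, fun ξ hξ => mollifierScale_eq_zero_of_unitBall_lt hφ1 hε hξ, mollifierScale_radial hφ.radial ε, ?_, ?_⟩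
  · rw [eT]
    refine integrable_mollifierScale ?_ hε
    rw [eT']; exact hT
  · intro ξ hξ
    rw [eT]
    exact mollifierScale_eq_zero_of_unitBall_lt (fun η hη => transverseKernel_eq_zero_of_lt hφ1 hη) hε hξ

omit [DecidableEq d] in
/-- **Integrability of the six pieces of `𝓔_T^{ε,φ}(ψ)`** on `(0,T) × T^d` for `u ∈ L³`, `p ∈ L^{3/2}`,
a nonnegative radial bump `φ` supported in the unit ball, `ε > 0` and a test function `ψ`:
`⟪u,u_T^ε⟫∂ₜψ`, `⟪u,u_T^ε⟫⟪u,∇ψ⟫`, `⟪((u_T·u_T)u)^ε,∇ψ⟫`, `(u_T·u_T)^ε⟪u,∇ψ⟫`, `p⟪u_T^ε,∇ψ⟫`,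
`p_T^ε⟪u,∇ψ⟫` (the Type I–IV integrability of `EyinkBalanceLimits`, with the crude translation
moduli `2‖u‖₃`, `2‖p‖_{3/2}`). [folklore] -/
theorem eyink_piecesT_integrable
    (hum : AEStronglyMeasurable (FunctionSpaces.Torus.stLift u) (volume.restrict (Ioo 0 T ×ˢ univ)))
    (hu3 : ∫⁻ t in Ioo 0 T, ∫⁻ x, ‖u t x‖ₑ ^ 3 < ⊤)
    (hpm : AEStronglyMeasurable (FunctionSpaces.Torus.stLift p) (volume.restrict (Ioo 0 T ×ˢ univ)))
    (hp32 : ∫⁻ t in Ioo 0 T, ∫⁻ x, ‖p t x‖ₑ ^ (3 / 2 : ℝ) < ⊤)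
    (hφ : IsRadialBump φ) (hφ0 : ∀ ξ, 0 ≤ φ ξ) (hφ1 : ∀ ξ, 1 < ‖ξ‖ → φ ξ = 0) (hε : 0 < ε)
    (hψ : FunctionSpaces.Torus.IsSpaceTimeTestIoo T ψ) :
    Integrable (fun q : ℝ × UnitAddTorus d =>
        ⟪u q.1 q.2, eyinkVelocityT φ ε (u q.1) q.2⟫ * FunctionSpaces.Torus.timeDeriv ψ q.1 q.2) (stMeasure d T) ∧
      Integrable (fun q : ℝ × UnitAddTorus d =>
        ⟪u q.1 q.2, eyinkVelocityT φ ε (u q.1) q.2⟫ * ⟪u q.1 q.2, FunctionSpaces.Torus.gradient (ψ q.1) q.2⟫) (stMeasure d T) ∧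
      Integrable (fun q : ℝ × UnitAddTorus d =>
        ⟪eyinkEnergyFluxT φ ε (u q.1) q.2, FunctionSpaces.Torus.gradient (ψ q.1) q.2⟫) (stMeasure d T) ∧
      Integrable (fun q : ℝ × UnitAddTorus d =>
        eyinkEnergyT φ ε (u q.1) q.2 * ⟪u q.1 q.2, FunctionSpaces.Torus.gradient (ψ q.1) q.2⟫) (stMeasure d T) ∧
      Integrable (fun q : ℝ × UnitAddTorus d =>
        p q.1 q.2 * ⟪eyinkVelocityT φ ε (u q.1) q.2, FunctionSpaces.Torus.gradient (ψ q.1) q.2⟫) (stMeasure d T) ∧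
      Integrable (fun q : ℝ × UnitAddTorus d =>
        eyinkPressureT φ ε (p q.1) q.2 * ⟪u q.1 q.2, FunctionSpaces.Torus.gradient (ψ q.1) q.2⟫) (stMeasure d T) := by
  set ν := stMeasure d T with hν
  -- product forms of the data
  have hu : AEStronglyMeasurable (uncurry u) ν := aestronglyMeasurable_uncurry_prod_of_stLift_Ioo hum
  have hu3' : ∫⁻ q, ‖uncurry u q‖ₑ ^ (3 : ℝ) ∂ν < ⊤ := by
    have h := lintegral_prod_enorm_pow_three_lt_top hu hu3
    have e : ∫⁻ q, ‖uncurry u q‖ₑ ^ 3 ∂ν = ∫⁻ q, ‖uncurry u q‖ₑ ^ (3 : ℝ) ∂ν :=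
      lintegral_congr fun q => ENNReal.pow_three_eq_rpow _
    rw [← e]; exact h
  have hu1 : ∫⁻ q, ‖uncurry u q‖ₑ ∂ν < ⊤ := by
    have h := lintegral_enorm_rpow_lt_top_of_le hu (by norm_num) hu3' one_pos (by norm_num : (1 : ℝ) ≤ 3)
    simpa only [ENNReal.rpow_one] using h
  have hp : AEStronglyMeasurable (uncurry p) ν := aestronglyMeasurable_uncurry_prod_of_stLift_Ioo' hpm
  have hp32' : ∫⁻ q, ‖uncurry p q‖ₑ ^ (3 / 2 : ℝ) ∂ν < ⊤ := by
    have e := lintegral_Ioo_lintegral_eq_lintegral_prod (T := T) (g := fun t x => ‖p t x‖ₑ ^ (3 / 2 : ℝ))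
      (hp.enorm.pow_const _)
    rw [e] at hp32
    exact hp32
  -- test data
  obtain ⟨Cψ, hCψ, hθb, hHb, hθm, hHm⟩ := hψ.testData_bound
  set θ : ℝ × UnitAddTorus d → ℝ := fun q => FunctionSpaces.Torus.timeDeriv ψ q.1 q.2 with hθdef
  set Hψ : ℝ × UnitAddTorus d → EuclideanSpace ℝ d := fun q => FunctionSpaces.Torus.gradient (ψ q.1) q.2 with hHdef
  have hθm' : AEStronglyMeasurable θ ν := hθm
  have hHm' : AEStronglyMeasurable Hψ ν := hHm
  -- the weight `g = ⟪u, ∇ψ⟫ ∈ L³`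
  set g : ℝ × UnitAddTorus d → ℝ := fun q => ⟪uncurry u q, Hψ q⟫ with hgdef
  have hgm : AEStronglyMeasurable g ν := hu.inner hHm'
  have hgb : ∀ q, |g q| ≤ Cψ * ‖uncurry u q‖ := fun q => by
    calc |⟪uncurry u q, Hψ q⟫| ≤ ‖uncurry u q‖ * ‖Hψ q‖ := abs_real_inner_le_norm _ _
      _ ≤ ‖uncurry u q‖ * Cψ := by gcongr; exact hHb q.1 q.2
      _ = Cψ * ‖uncurry u q‖ := mul_comm _ _
  have hg3 : ∫⁻ q, ‖g q‖ₑ ^ (3 : ℝ) ∂ν < ⊤ := lintegral_enorm_rpow_three_lt_top_of_le hCψ hgb hu3'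
  -- the three Type-I weights in `L^{3/2}`
  have hu32 : ∫⁻ q, ‖uncurry u q‖ₑ ^ (3 / 2 : ℝ) ∂ν < ⊤ :=
    lintegral_enorm_rpow_lt_top_of_le hu (by norm_num) hu3' (by norm_num) (by norm_num)
  set c₁ : ℝ × UnitAddTorus d → EuclideanSpace ℝ d := fun q => θ q • uncurry u q with hc₁
  set c₂ : ℝ × UnitAddTorus d → EuclideanSpace ℝ d := fun q => g q • uncurry u q with hc₂
  set c₃ : ℝ × UnitAddTorus d → EuclideanSpace ℝ d := fun q => uncurry p q • Hψ q with hc₃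
  have hc₁m : AEStronglyMeasurable c₁ ν := hθm'.smul hu
  have hc₂m : AEStronglyMeasurable c₂ ν := hgm.smul hu
  have hc₃m : AEStronglyMeasurable c₃ ν := hp.smul hHm'
  have hc₁32 : ∫⁻ q, ‖c₁ q‖ₑ ^ (3 / 2 : ℝ) ∂ν < ⊤ := by
    refine lintegral_enorm_rpow_lt_top_of_norm_le hCψ (by norm_num) (fun q => ?_) hu32
    rw [hc₁, norm_smul, Real.norm_eq_abs]
    gcongr
    exact hθb q.1 q.2
  have hc₂32 : ∫⁻ q, ‖c₂ q‖ₑ ^ (3 / 2 : ℝ) ∂ν < ⊤ := by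
    have hsq : ∫⁻ q, ‖‖uncurry u q‖ ^ 2‖ₑ ^ (3 / 2 : ℝ) ∂ν < ⊤ := by
      have e : ∀ q, ‖‖uncurry u q‖ ^ 2‖ₑ ^ (3 / 2 : ℝ) = ‖uncurry u q‖ₑ ^ (3 : ℝ) := fun q => by
        rw [enorm_norm_pow, ENNReal.sq_rpow_three_halves]
      simp only [e]; exact hu3'
    refine lintegral_enorm_rpow_lt_top_of_norm_le hCψ (by norm_num) (fun q => ?_) hsq
    show ‖g q • uncurry u q‖ ≤ Cψ * ‖‖uncurry u q‖ ^ 2‖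
    rw [norm_smul, Real.norm_eq_abs, Real.norm_of_nonneg (sq_nonneg _), sq, ← mul_assoc]
    gcongr
    exact hgb q
  have hc₃32 : ∫⁻ q, ‖c₃ q‖ₑ ^ (3 / 2 : ℝ) ∂ν < ⊤ := by
    refine lintegral_enorm_rpow_lt_top_of_norm_le hCψ (by norm_num) (fun q => ?_) hp32'
    rw [hc₃, norm_smul, mul_comm]
    gcongr
    exact hHb q.1 q.2
  -- kernels, projections, angular identities
  obtain ⟨hk, hksupp, hkrad, hkT, hkTsupp⟩ := transverse_kernels_facts hφ hφ0 hφ1 hε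
  have hAT : ∀ ξ v : EuclideanSpace ℝ d, ‖projT (‖ξ‖⁻¹ • ξ) v‖ ≤ 2 * ‖v‖ := fun ξ v => norm_projT_unit_le ξ v
  have hAngI : ∀ a c : EuclideanSpace ℝ d, ∫ ξ, FluidPDE.mollifierScale ε φ ξ * ⟪projT (‖ξ‖⁻¹ • ξ) a, c⟫ =
      (((Fintype.card d : ℝ) - 1) / Fintype.card d * ∫ ξ, FluidPDE.mollifierScale ε φ ξ) * ⟪a, c⟫ := fun a c =>
    integral_mul_inner_projT hk hkrad a c
  have hAngII : ∀ a : EuclideanSpace ℝ d, ∫ ξ, FluidPDE.mollifierScale ε φ ξ * ‖projT (‖ξ‖⁻¹ • ξ) a‖ ^ 2 =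
      (((Fintype.card d : ℝ) - 1) / Fintype.card d * ∫ ξ, FluidPDE.mollifierScale ε φ ξ) * ‖a‖ ^ 2 := fun a =>
    integral_mul_norm_projT_sq hk hkrad a
  -- crude moduli
  set m : ℝ≥0∞ := 2 * (∫⁻ q, ‖uncurry u q‖ₑ ^ (3 : ℝ) ∂ν) ^ (1 / 3 : ℝ) with hmdef
  have hm : m ≠ ⊤ := ENNReal.mul_ne_top (by simp) (ENNReal.rpow_ne_top_of_nonneg (by norm_num) hu3'.ne)
  have hmod : ∀ ξ : EuclideanSpace ℝ d, ‖ξ‖ ≤ ε →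
      (∫⁻ q, ‖uncurry u (stTranslate d ξ q) - uncurry u q‖ₑ ^ (3 : ℝ) ∂ν) ^ (1 / 3 : ℝ) ≤ m := fun ξ _ =>
    lintegral_translate_sub_rpow_le hu (by norm_num) ξ
  set mP : ℝ≥0∞ := 2 * (∫⁻ q, ‖uncurry p q‖ₑ ^ (3 / 2 : ℝ) ∂ν) ^ (2 / 3 : ℝ) with hmPdef
  have hmP : mP ≠ ⊤ := ENNReal.mul_ne_top (by simp) (ENNReal.rpow_ne_top_of_nonneg (by norm_num) hp32'.ne)
  have hmodP : ∀ ξ : EuclideanSpace ℝ d, ‖ξ‖ ≤ ε →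
      (∫⁻ q, ‖uncurry p (stTranslate d ξ q) - uncurry p q‖ₑ ^ (3 / 2 : ℝ) ∂ν) ^ (2 / 3 : ℝ) ≤ mP := fun ξ _ => by
    have h := lintegral_translate_sub_rpow_le hp (by norm_num : (1 : ℝ) ≤ 3 / 2) ξ
    have e : (1 : ℝ) / (3 / 2) = 2 / 3 := by norm_num
    simpa only [e] using h
  -- the unfolding lemmas (a.e.)
  have hV : ∀ q : ℝ × UnitAddTorus d, eyinkVelocityT φ ε (u q.1) q.2 =
      ∫ ξ, FluidPDE.mollifierScale ε φ ξ • projT (‖ξ‖⁻¹ • ξ) (uncurry u (stTranslate d ξ q)) := fun q =>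
    (eyink_objectsT_eq φ ε (u q.1) q.2).1
  have hE : ∀ q : ℝ × UnitAddTorus d, eyinkEnergyT φ ε (u q.1) q.2 =
      ∫ ξ, FluidPDE.mollifierScale ε φ ξ * ‖projT (‖ξ‖⁻¹ • ξ) (uncurry u (stTranslate d ξ q))‖ ^ 2 := fun q =>
    (eyink_objectsT_eq φ ε (u q.1) q.2).2.1
  have hF : ∀ q : ℝ × UnitAddTorus d, eyinkEnergyFluxT φ ε (u q.1) q.2 =
      ∫ ξ, (FluidPDE.mollifierScale ε φ ξ * ‖projT (‖ξ‖⁻¹ • ξ) (uncurry u (stTranslate d ξ q))‖ ^ 2) •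
        uncurry u (stTranslate d ξ q) := fun q =>
    (eyink_objectsT_eq φ ε (u q.1) q.2).2.2
  have hP : ∀ q : ℝ × UnitAddTorus d, eyinkPressureT φ ε (p q.1) q.2 =
      ∫ ξ, eyinkTransverseKernel d (FluidPDE.mollifierScale ε φ) ξ * uncurry p (stTranslate d ξ q) := fun q =>
    eyinkPressureT_apply φ ε (p q.1) q.2
  -- Type I pieces
  have pieceI : ∀ {c : ℝ × UnitAddTorus d → EuclideanSpace ℝ d}, AEStronglyMeasurable c ν →
      (∫⁻ q, ‖c q‖ₑ ^ (3 / 2 : ℝ) ∂ν < ⊤) →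
      Integrable (fun q : ℝ × UnitAddTorus d => ⟪eyinkVelocityT φ ε (u q.1) q.2, c q⟫) ν := by
    intro c hcm hc32
    obtain ⟨hI, -⟩ := typeI_estimate (T := T) hk hksupp projT (by norm_num : (0 : ℝ) ≤ 2) hAT continuous_projT hAngI
      hu hu3' hcm hc32 hm hmod
    have hae := ae_inner_integral_kernel_smul_eq (T := T) hk projT hAT continuous_projT hu hu1 c
    refine (hI.integral_prod_left).congr ?_
    filter_upwards [hae] with q hq
    rw [hV q, hq.2]
  have hunc : ∀ q : ℝ × UnitAddTorus d, uncurry u q = u q.1 q.2 := fun q => rfl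
  have huncp : ∀ q : ℝ × UnitAddTorus d, uncurry p q = p q.1 q.2 := fun q => rfl
  refine ⟨?_, ?_, ?_, ?_, ?_, ?_⟩
  · refine (pieceI hc₁m hc₁32).congr (ae_of_all _ fun q => ?_)
    simp only [hc₁, real_inner_smul_right, hunc, hθdef]
    rw [real_inner_comm]
    ring
  · refine (pieceI hc₂m hc₂32).congr (ae_of_all _ fun q => ?_)
    simp only [hc₂, real_inner_smul_right, hunc, hgdef, hHdef]
    rw [real_inner_comm (eyinkVelocityT φ ε (u q.1) q.2)]
    ring
  · -- Type III
    obtain ⟨hI, -⟩ := typeIII_estimate (T := T) hk hksupp projT (by norm_num : (0 : ℝ) ≤ 2) hAT continuous_projT hAngII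
      hu hu3' hHm' hCψ (fun q => hHb q.1 q.2) hm hmod
    have hae := ae_inner_integral_kernel_normSq_smul_eq (T := T) hk projT hAT continuous_projT hu hu3' Hψ
    refine (hI.integral_prod_left).congr ?_
    filter_upwards [hae] with q hq
    rw [hF q, hq.2]
  · -- Type II
    obtain ⟨hI, -⟩ := typeII_estimate (T := T) hk hksupp projT (by norm_num : (0 : ℝ) ≤ 2) hAT continuous_projT hAngII
      hu hu3' hgm hg3 hm hmod
    refine (hI.integral_prod_left).congr (ae_of_all _ fun q => ?_)
    simp only
    rw [hE q, ← integral_mul_const]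
    refine integral_congr_ae (ae_of_all _ fun ξ => ?_)
    simp only [hgdef, hunc, hHdef]
    ring
  · refine (pieceI hc₃m hc₃32).congr (ae_of_all _ fun q => ?_)
    simp only [hc₃, real_inner_smul_right, huncp, hHdef]
  · -- Type IV
    obtain ⟨hI, -⟩ := typeIV_estimate (T := T) hkT hkTsupp hp hp32' hgm hg3 hmP hmodP
    refine (hI.integral_prod_left).congr (ae_of_all _ fun q => ?_)
    simp only
    rw [hP q, ← integral_mul_const]
    refine integral_congr_ae (ae_of_all _ fun ξ => ?_)
    simp only [hgdef, hunc, hHdef]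
    ring

end Pieces

end Literature.Analysis.FluidPDE.Torus

namespace Literature.Analysis.FluidPDE.Torus

variable {d : Type*} [Fintype d] [DecidableEq d]

/-! ## Time slices of the data -/

section Slices

variable {T : ℝ} {u : ℝ → UnitAddTorus d → EuclideanSpace ℝ d} {p : ℝ → UnitAddTorus d → ℝ}

omit [DecidableEq d] in
/-- Almost every time slice of a jointly measurable `u ∈ L³((0,T) × T^d)` is in `L³(T^d)`. [folklore] -/
theorem ae_memLp_three_of_stLift
    (hum : AEStronglyMeasurable (FunctionSpaces.Torus.stLift u) (volume.restrict (Ioo 0 T ×ˢ univ)))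
    (hu3 : ∫⁻ t in Ioo 0 T, ∫⁻ x, ‖u t x‖ₑ ^ 3 < ⊤) :
    ∀ᵐ t ∂(volume.restrict (Ioo 0 T)), MemLp (u t) 3 volume := by
  have hu := aestronglyMeasurable_uncurry_prod_of_stLift_Ioo hum
  have h1 : ∀ᵐ t ∂(volume.restrict (Ioo 0 T)), AEStronglyMeasurable (u t) volume := hu.prodMk_left
  have h2m : AEMeasurable (fun t => ∫⁻ x, ‖u t x‖ₑ ^ 3) (volume.restrict (Ioo 0 T)) :=
    (hu.enorm.pow_const 3).lintegral_prod_right'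
  have h2 : ∀ᵐ t ∂(volume.restrict (Ioo 0 T)), ∫⁻ x, ‖u t x‖ₑ ^ 3 < ⊤ := ae_lt_top' h2m hu3.ne
  filter_upwards [h1, h2] with t h1 h2
  refine ⟨h1, ?_⟩
  rw [eLpNorm_lt_top_iff_lintegral_rpow_enorm_lt_top (by norm_num) (by norm_num)]
  simpa only [ENNReal.toReal_ofNat, ENNReal.rpow_ofNat] using h2

omit [DecidableEq d] in
/-- Almost every time slice of a jointly measurable `p ∈ L^{3/2}((0,T) × T^d)` is integrable on `T^d`. [folklore] -/
theorem ae_integrable_of_stLift_threeHalves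
    (hpm : AEStronglyMeasurable (FunctionSpaces.Torus.stLift p) (volume.restrict (Ioo 0 T ×ˢ univ)))
    (hp32 : ∫⁻ t in Ioo 0 T, ∫⁻ x, ‖p t x‖ₑ ^ (3 / 2 : ℝ) < ⊤) :
    ∀ᵐ t ∂(volume.restrict (Ioo 0 T)), Integrable (p t) volume := by
  have hp := aestronglyMeasurable_uncurry_prod_of_stLift_Ioo' (T := T) hpm
  have h1 : ∀ᵐ t ∂(volume.restrict (Ioo 0 T)), AEStronglyMeasurable (p t) volume := hp.prodMk_left
  have h2m : AEMeasurable (fun t => ∫⁻ x, ‖p t x‖ₑ ^ (3 / 2 : ℝ)) (volume.restrict (Ioo 0 T)) :=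
    (hp.enorm.pow_const _).lintegral_prod_right'
  have h2 : ∀ᵐ t ∂(volume.restrict (Ioo 0 T)), ∫⁻ x, ‖p t x‖ₑ ^ (3 / 2 : ℝ) < ⊤ := ae_lt_top' h2m hp32.ne
  filter_upwards [h1, h2] with t h1 h2
  have h32 : (0 : ℝ) < 3 / 2 := by norm_num
  have hM : MemLp (p t) (ENNReal.ofReal (3 / 2)) volume := by
    refine ⟨h1, (eLpNorm_lt_top_iff_lintegral_rpow_enorm_lt_top (by simp [h32]) ENNReal.ofReal_ne_top).2 ?_⟩
    simpa only [ENNReal.toReal_ofReal h32.le] using h2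
  refine hM.integrable ?_
  rw [← ENNReal.ofReal_one]
  exact ENNReal.ofReal_le_ofReal (by norm_num)

end Slices

/-! ## The transverse balance pairing as the sum of its six integrals -/

section Split

variable [Nonempty d] {T ε : ℝ} {φ : EuclideanSpace ℝ d → ℝ} {u : ℝ → UnitAddTorus d → EuclideanSpace ℝ d}
  {p : ℝ → UnitAddTorus d → ℝ} {ψ : ℝ → UnitAddTorus d → ℝ}

omit [DecidableEq d] in
/-- **`𝓔_T^{ε,φ}(ψ)` as the six-term sum of `Torus.matPairing` shape**:
`𝓔_T = 2∫∫⟪u,u_T⟫∂ₜψ + 2∫∫⟪u,u_T⟫⟪u,∇ψ⟫ + ∫∫⟪((u_T·u_T)u)^ε,∇ψ⟫ − ∫∫(u_T·u_T)^ε⟪u,∇ψ⟫ + 2∫∫p⟪u_T,∇ψ⟫ + 2∫∫p_T⟪u,∇ψ⟫`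
(each piece integrable on `(0,T) × T^d`, `eyink_piecesT_integrable`; Fubini). [cite: Eyink2003, §2 (uuT-eq)] -/
theorem eyinkBalanceT_eq_sum
    (hum : AEStronglyMeasurable (FunctionSpaces.Torus.stLift u) (volume.restrict (Ioo 0 T ×ˢ univ)))
    (hu3 : ∫⁻ t in Ioo 0 T, ∫⁻ x, ‖u t x‖ₑ ^ 3 < ⊤)
    (hpm : AEStronglyMeasurable (FunctionSpaces.Torus.stLift p) (volume.restrict (Ioo 0 T ×ˢ univ)))
    (hp32 : ∫⁻ t in Ioo 0 T, ∫⁻ x, ‖p t x‖ₑ ^ (3 / 2 : ℝ) < ⊤)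
    (hφ : IsRadialBump φ) (hφ0 : ∀ ξ, 0 ≤ φ ξ) (hφ1 : ∀ ξ, 1 < ‖ξ‖ → φ ξ = 0) (hε : 0 < ε)
    (hψ : FunctionSpaces.Torus.IsSpaceTimeTestIoo T ψ) :
    eyinkBalanceT T u p φ ε ψ =
      2 * (∫ t in Ioo 0 T, ∫ x, ⟪u t x, eyinkVelocityT φ ε (u t) x⟫ * FunctionSpaces.Torus.timeDeriv ψ t x) +
      2 * (∫ t in Ioo 0 T, ∫ x,
        ⟪u t x, eyinkVelocityT φ ε (u t) x⟫ * ⟪u t x, FunctionSpaces.Torus.gradient (ψ t) x⟫) +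
      (∫ t in Ioo 0 T, ∫ x, ⟪eyinkEnergyFluxT φ ε (u t) x, FunctionSpaces.Torus.gradient (ψ t) x⟫) -
      (∫ t in Ioo 0 T, ∫ x, eyinkEnergyT φ ε (u t) x * ⟪u t x, FunctionSpaces.Torus.gradient (ψ t) x⟫) +
      2 * (∫ t in Ioo 0 T, ∫ x,
        p t x * ⟪eyinkVelocityT φ ε (u t) x, FunctionSpaces.Torus.gradient (ψ t) x⟫) +
      2 * (∫ t in Ioo 0 T, ∫ x,
        eyinkPressureT φ ε (p t) x * ⟪u t x, FunctionSpaces.Torus.gradient (ψ t) x⟫) := by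
  obtain ⟨hA, hB, hC, hD, hE, hF⟩ := eyink_piecesT_integrable hum hu3 hpm hp32 hφ hφ0 hφ1 hε hψ
  set ν := stMeasure d T with hν
  -- each iterated integral is a product integral
  rw [← integral_prod _ hA, ← integral_prod _ hB, ← integral_prod _ hC, ← integral_prod _ hD, ← integral_prod _ hE,
    ← integral_prod _ hF]
  -- the total integrand
  have hTot : Integrable (fun q : ℝ × UnitAddTorus d =>
      2 * (⟪u q.1 q.2, eyinkVelocityT φ ε (u q.1) q.2⟫ * FunctionSpaces.Torus.timeDeriv ψ q.1 q.2) +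
      2 * (⟪u q.1 q.2, eyinkVelocityT φ ε (u q.1) q.2⟫ * ⟪u q.1 q.2, FunctionSpaces.Torus.gradient (ψ q.1) q.2⟫) +
      ⟪eyinkEnergyFluxT φ ε (u q.1) q.2, FunctionSpaces.Torus.gradient (ψ q.1) q.2⟫ -
      eyinkEnergyT φ ε (u q.1) q.2 * ⟪u q.1 q.2, FunctionSpaces.Torus.gradient (ψ q.1) q.2⟫ +
      2 * (p q.1 q.2 * ⟪eyinkVelocityT φ ε (u q.1) q.2, FunctionSpaces.Torus.gradient (ψ q.1) q.2⟫) +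
      2 * (eyinkPressureT φ ε (p q.1) q.2 * ⟪u q.1 q.2, FunctionSpaces.Torus.gradient (ψ q.1) q.2⟫)) ν :=
    (((((hA.const_mul 2).add (hB.const_mul 2)).add hC).sub hD).add (hE.const_mul 2)).add (hF.const_mul 2)
  have hBL : eyinkBalanceT T u p φ ε ψ = ∫ q, (
      2 * (⟪u q.1 q.2, eyinkVelocityT φ ε (u q.1) q.2⟫ * FunctionSpaces.Torus.timeDeriv ψ q.1 q.2) +
      2 * (⟪u q.1 q.2, eyinkVelocityT φ ε (u q.1) q.2⟫ * ⟪u q.1 q.2, FunctionSpaces.Torus.gradient (ψ q.1) q.2⟫) +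
      ⟪eyinkEnergyFluxT φ ε (u q.1) q.2, FunctionSpaces.Torus.gradient (ψ q.1) q.2⟫ -
      eyinkEnergyT φ ε (u q.1) q.2 * ⟪u q.1 q.2, FunctionSpaces.Torus.gradient (ψ q.1) q.2⟫ +
      2 * (p q.1 q.2 * ⟪eyinkVelocityT φ ε (u q.1) q.2, FunctionSpaces.Torus.gradient (ψ q.1) q.2⟫) +
      2 * (eyinkPressureT φ ε (p q.1) q.2 * ⟪u q.1 q.2, FunctionSpaces.Torus.gradient (ψ q.1) q.2⟫)) ∂ν := by
    rw [integral_prod _ hTot, eyinkBalanceT]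
    refine setIntegral_congr_fun measurableSet_Ioo fun t _ => ?_
    refine integral_congr_ae (ae_of_all _ fun x => ?_)
    simp only
    ring
  rw [hBL, integral_add, integral_add, integral_sub, integral_add, integral_add, integral_const_mul, integral_const_mul,
    integral_const_mul, integral_const_mul]
  · exact hA.const_mul 2
  · exact hB.const_mul 2
  · exact (hA.const_mul 2).add (hB.const_mul 2)
  · exact hC
  · exact ((hA.const_mul 2).add (hB.const_mul 2)).add hC
  · exact hD
  · exact (((hA.const_mul 2).add (hB.const_mul 2)).add hC).sub hD
  · exact hE.const_mul 2
  · exact ((((hA.const_mul 2).add (hB.const_mul 2)).add hC).sub hD).add (hE.const_mul 2)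
  · exact hF.const_mul 2

end Split

end Literature.Analysis.FluidPDE.Torus

namespace Literature.Analysis.FluidPDE.Torus

variable {d : Type*} [Fintype d] [DecidableEq d]

/-! ## The transverse balance at scale `ε` for an excised bump, from the matrix facts -/

section Identity

variable [Nonempty d] {T ε r₀ : ℝ} {φ : EuclideanSpace ℝ d → ℝ} {u : ℝ → UnitAddTorus d → EuclideanSpace ℝ d}
  {p : ℝ → UnitAddTorus d → ℝ} {ψ : ℝ → UnitAddTorus d → ℝ}

/-- **Eyink's (uuT-eq) at scale `ε`, for a mollifier profile excised at the origin, from the matrix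
facts.** Granted the tree's named facts `Torus.integral_matKernelFlux_mul_eq` (matrix cubic
identity) and `Torus.IsDistributionalNSSolutionOn.matSymmTestField_identity` (tested momentum
equation), for every distributional Euler solution `(u, p)` on `T^d × (0,T)` with `u ∈ L³`,
`p ∈ L^{3/2}`, every nonnegative radial bump `φ` supported in the unit ball and **vanishing on a
ball around the origin**, every `ε > 0` and every test function `ψ` supported in `(0,T)`:
`𝓔_T^{ε,φ}(ψ) = ∫₀ᵀ∫ (∫ {∇φ^ε·δu |δu_T|² − (2/|ξ|)φ^ε δu_L|δu_T|²} dξ) ψ`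
(Eyink 2003, §2: (simp-eq-u-LT) with `∇·Π_T^ε = ∇p_T^ε`, the incompressibility of `u_T^ε`, and
(id-T) give (uuT-eq); here: the two matrix facts and the proved pressure step
`Torus.integral_pressure_divergence_matSymmTestField` for the smooth kernel `M_T = periodize m_T`,
`ζ = periodize (Z_T∘|·|²)`, transported to Eyink's objects by the bridges of this file). [cite: Eyink2003, §2 (uuT-eq)] -/
theorem eyinkBalanceT_eq_flux_of_matrix_facts
    (h1 : integral_matKernelFlux_mul_eq (d := d))
    (h2 : IsDistributionalNSSolutionOn.matSymmTestField_identity (d := d))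
    (hsol : IsDistributionalNSSolutionOn T 0 0 u p)
    (hu3 : ∫⁻ t in Ioo 0 T, ∫⁻ x, ‖u t x‖ₑ ^ 3 < ⊤)
    (hp : ∫⁻ t in Ioo 0 T, ∫⁻ x, ‖p t x‖ₑ ^ (3 / 2 : ℝ) < ⊤)
    (hφ : IsRadialBump φ) (hφ0 : ∀ ξ, 0 ≤ φ ξ) (hφ1 : ∀ ξ, 1 < ‖ξ‖ → φ ξ = 0)
    (hr₀ : 0 < r₀) (h0 : ∀ ξ : EuclideanSpace ℝ d, ‖ξ‖ < r₀ → φ ξ = 0) (hε : 0 < ε)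
    (hψ : FunctionSpaces.Torus.IsSpaceTimeTestIoo T ψ) :
    eyinkBalanceT T u p φ ε ψ =
      ∫ t in Ioo 0 T, ∫ x, (∫ ξ, eyinkTransverseIntegrand φ ε (u t) x ξ) * ψ t x := by
  obtain ⟨hG, hGa, ⟨R, hR0, hGR, -⟩, -⟩ := eyinkProfile_facts hφ hr₀ h0 hε
  have ha : 0 < (ε * r₀) ^ 2 := by positivity
  set G := eyinkProfile φ ε with hGdef
  set M : d → d → UnitAddTorus d → ℝ := eyinkMatKernelT G with hMdef
  set ζ : UnitAddTorus d → ℝ := eyinkPotentialT d G with hζdef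
  have hM : ∀ i j, FunctionSpaces.Torus.IsSmooth (M i j) := isSmooth_eyinkMatKernelT hG ha hGa hR0 hGR
  have hMev : ∀ i j z, M i j (-z) = M i j z := eyinkMatKernelT_neg G
  have hMsymm : ∀ i j, M i j = M j i := eyinkMatKernelT_comm G
  have hζ : FunctionSpaces.Torus.IsSmooth ζ := isSmooth_eyinkPotentialT hG ha hGa hR0 hGR
  have hζev : ∀ z, ζ (-z) = ζ z := eyinkPotentialT_neg G
  have hpot : ∀ j x, ∑ i, FunctionSpaces.Torus.partialDeriv i (M i j) x = FunctionSpaces.Torus.partialDeriv j ζ x :=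
    sum_partialDeriv_eyinkMatKernelT hG ha hGa hR0 hGR
  -- the data
  have hum := hsol.1
  have hpm := hsol.2.2.1
  have hdiv := hsol.2.2.2.2.1
  -- the three identities
  have H1 := h1 hum hu3 hdiv hM hMev hMsymm hψ
  have H2 := h2 hsol hu3 hp hM hMev hMsymm hψ
  have HP := integral_pressure_divergence_matSymmTestField hum hu3 hdiv hpm hp hM hζ hζev hpot hψ
  -- slices
  have hsu := ae_memLp_three_of_stLift hum hu3
  have hsp := ae_integrable_of_stLift_threeHalves hpm hp
  -- bridges, integral by integral
  have eA : (∫ t in Ioo 0 T, ∫ x, ⟪u t x, matConv (u t) M x⟫ * FunctionSpaces.Torus.timeDeriv ψ t x) =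
      ∫ t in Ioo 0 T, ∫ x, ⟪u t x, eyinkVelocityT φ ε (u t) x⟫ * FunctionSpaces.Torus.timeDeriv ψ t x := by
    refine integral_congr_ae ?_
    filter_upwards [hsu] with t ht
    refine integral_congr_ae (ae_of_all _ fun x => ?_)
    simp only
    rw [matConv_eyinkMatKernelT_eq hφ hr₀ h0 hε (ht.integrable (by norm_num)) x]
  have eB : (∫ t in Ioo 0 T, ∫ x, ⟪u t x, matConv (u t) M x⟫ * ⟪u t x, FunctionSpaces.Torus.gradient (ψ t) x⟫) =
      ∫ t in Ioo 0 T, ∫ x, ⟪u t x, eyinkVelocityT φ ε (u t) x⟫ * ⟪u t x, FunctionSpaces.Torus.gradient (ψ t) x⟫ := by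
    refine integral_congr_ae ?_
    filter_upwards [hsu] with t ht
    refine integral_congr_ae (ae_of_all _ fun x => ?_)
    simp only
    rw [matConv_eyinkMatKernelT_eq hφ hr₀ h0 hε (ht.integrable (by norm_num)) x]
  have eC : (∫ t in Ioo 0 T, ∫ x, ⟪matConvCube (u t) M x, FunctionSpaces.Torus.gradient (ψ t) x⟫) =
      ∫ t in Ioo 0 T, ∫ x, ⟪eyinkEnergyFluxT φ ε (u t) x, FunctionSpaces.Torus.gradient (ψ t) x⟫ := by
    refine integral_congr_ae ?_
    filter_upwards [hsu] with t ht
    refine integral_congr_ae (ae_of_all _ fun x => ?_)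
    simp only
    rw [matConvCube_eyinkMatKernelT_eq hφ hr₀ h0 hε ht x]
  have eD : (∫ t in Ioo 0 T, ∫ x, matConvSq (u t) M x * ⟪u t x, FunctionSpaces.Torus.gradient (ψ t) x⟫) =
      ∫ t in Ioo 0 T, ∫ x, eyinkEnergyT φ ε (u t) x * ⟪u t x, FunctionSpaces.Torus.gradient (ψ t) x⟫ := by
    refine integral_congr_ae ?_
    filter_upwards [hsu] with t ht
    refine integral_congr_ae (ae_of_all _ fun x => ?_)
    simp only
    rw [matConvSq_eyinkMatKernelT_eq hφ hr₀ h0 hε (ht.mono_exponent (by norm_num)) x]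
  have eE : (∫ t in Ioo 0 T, ∫ x, p t x * ⟪matConv (u t) M x, FunctionSpaces.Torus.gradient (ψ t) x⟫) =
      ∫ t in Ioo 0 T, ∫ x, p t x * ⟪eyinkVelocityT φ ε (u t) x, FunctionSpaces.Torus.gradient (ψ t) x⟫ := by
    refine integral_congr_ae ?_
    filter_upwards [hsu] with t ht
    refine integral_congr_ae (ae_of_all _ fun x => ?_)
    simp only
    rw [matConv_eyinkMatKernelT_eq hφ hr₀ h0 hε (ht.integrable (by norm_num)) x]
  have eF : (∫ t in Ioo 0 T, ∫ x, (p t ⋆ ζ) x * ⟪u t x, FunctionSpaces.Torus.gradient (ψ t) x⟫) =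
      ∫ t in Ioo 0 T, ∫ x, eyinkPressureT φ ε (p t) x * ⟪u t x, FunctionSpaces.Torus.gradient (ψ t) x⟫ := by
    refine integral_congr_ae ?_
    filter_upwards [hsp] with t ht
    refine integral_congr_ae (ae_of_all _ fun x => ?_)
    simp only
    rw [convolution_eyinkPotentialT_eq hφ hr₀ h0 hε ht x]
  have eFlux : (∫ t in Ioo 0 T, ∫ x, matKernelFlux M (u t) x * ψ t x) =
      ∫ t in Ioo 0 T, ∫ x, (∫ ξ, eyinkTransverseIntegrand φ ε (u t) x ξ) * ψ t x := by
    refine integral_congr_ae ?_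
    filter_upwards [hsu] with t ht
    refine integral_congr_ae (ae_of_all _ fun x => ?_)
    simp only
    rw [matKernelFlux_eyinkMatKernelT_eq hφ hr₀ h0 hε ht x]
  -- assemble
  rw [eyinkBalanceT_eq_sum hum hu3 hpm hp hφ hφ0 hφ1 hε hψ, ← eA, ← eB, ← eC, ← eD, ← eE, ← eF, ← eFlux]
  rw [zero_mul, add_zero] at H2
  linarith [H1, H2, HP]

/-- The same identity with Eyink's normalised approximant `D_T^ε = (d/(4(d−1))) ∫ {…} dξ` of
`EyinkLocalFourFifths`: in dimension `d ≥ 2`,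
`𝓔_T^{ε,φ}(ψ) = (4(d−1)/d) ∫₀ᵀ∫ D_T^ε(u) ψ` — the conclusion of the named fact
`Torus.eyink_transverse_balance`, here for profiles excised at the origin. [cite: Eyink2003, §2 (uuT-eq)] -/
theorem eyinkBalanceT_eq_of_matrix_facts (hd : 2 ≤ Fintype.card d)
    (h1 : integral_matKernelFlux_mul_eq (d := d))
    (h2 : IsDistributionalNSSolutionOn.matSymmTestField_identity (d := d))
    (hsol : IsDistributionalNSSolutionOn T 0 0 u p)
    (hu3 : ∫⁻ t in Ioo 0 T, ∫⁻ x, ‖u t x‖ₑ ^ 3 < ⊤)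
    (hp : ∫⁻ t in Ioo 0 T, ∫⁻ x, ‖p t x‖ₑ ^ (3 / 2 : ℝ) < ⊤)
    (hφ : IsRadialBump φ) (hφ0 : ∀ ξ, 0 ≤ φ ξ) (hφ1 : ∀ ξ, 1 < ‖ξ‖ → φ ξ = 0)
    (hr₀ : 0 < r₀) (h0 : ∀ ξ : EuclideanSpace ℝ d, ‖ξ‖ < r₀ → φ ξ = 0) (hε : 0 < ε)
    (hψ : FunctionSpaces.Torus.IsSpaceTimeTestIoo T ψ) :
    eyinkBalanceT T u p φ ε ψ =
      4 * ((Fintype.card d : ℝ) - 1) / Fintype.card d *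
        ∫ t in Ioo 0 T, ∫ x, eyinkTransverseApprox φ ε (u t) x * ψ t x := by
  rw [eyinkBalanceT_eq_flux_of_matrix_facts h1 h2 hsol hu3 hp hφ hφ0 hφ1 hr₀ h0 hε hψ]
  have hd' : (2 : ℝ) ≤ Fintype.card d := by exact_mod_cast hd
  have hn : (Fintype.card d : ℝ) ≠ 0 := by linarith
  have hn1 : (Fintype.card d : ℝ) - 1 ≠ 0 := by linarith
  simp only [eyinkTransverseApprox, eyinkTransverseConst]
  have e : ∀ t x, (Fintype.card d : ℝ) / (4 * ((Fintype.card d : ℝ) - 1)) *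
      (∫ ξ, eyinkTransverseIntegrand φ ε (u t) x ξ) * ψ t x =
      (Fintype.card d : ℝ) / (4 * ((Fintype.card d : ℝ) - 1)) *
        ((∫ ξ, eyinkTransverseIntegrand φ ε (u t) x ξ) * ψ t x) := fun t x => by ring
  simp_rw [e, integral_const_mul]
  field_simp

end Identity

end Literature.Analysis.FluidPDE.Torus
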